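import Literature.NumberTheory.GaloisRepresentations.IdeleClassBarSModPairingValues
import Literature.NumberTheory.GaloisRepresentations.IdeleClassBarModAlphaOneInjective
import Literature.NumberTheory.GaloisRepresentations.GlobalReciprocityModPowersUnramifiedLayers
import Literature.NumberTheory.GaloisRepresentations.RestrictedRamificationLayerEmbedding
import Literature.NumberTheory.GaloisRepresentations.RestrictedRamificationUnramifiedSubfields
import HarnessLib

/-!
# Milne's (b) for `(Gal(K_S/L), Res C̄_S)`, injectivity side: a vector `φ : ℤ → Res C̄_S` pairing to zero with all
# trace-layer characters is divisible by `m` (Milne ADT I Thm. 1.8 (b), §4; Harari Thm. 17.2; Tate C–F VII §11.3)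

Topic `NumberTheory/GaloisRepresentations`; namespace `Literature.NumberTheory.GaloisRepresentations.IdeleClassBar`.  The S-port
of door-c4 g16/g17's `IdeleClassBarModPairingArtin` (§26–§28) and `IdeleClassBarModAlphaOneInjective` (§31–§33) to the
`S`-idèle class formation `(G_S, C̄_S)` at `W = V̄_L = layerSubgroupS S L` (`L ⊆ K_S`), for an ABSTRACT invariant map `inv`
satisfying `hinv` at every layer `E ⊇ L` inside `K_S` (the conclusion of bsd-line-x1-p1-w5's `invAt_classBarSD_inflG`, i.e.
`inv = invAt (classBarSD K S) inv_S V̄_L`).  Three definitions with bodies (PLUMBING: a group isomorphism and two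
character dictionaries) and theorems; no named fact, no instance, no notation, no `sorry`.

* §1 `galTraceQuotEquivS S h hE : Gal(E/L) ≃* ↥V̄_L ⧸ (V̄_E ∩ V̄_L)`, the characters `galCharacterS S h hE χ = [χ] ∘ g_S` of
  `Gal(E/L)` and `traceCharacterS` (inverse), `H¹(g_S, 𝟙) χ = [galCharacterS χ]`.
* §2 `coe_baseInvariant_eq_transHom`: door-c6's `ι[x] ∈ C_E^{Gal(E/L)}` is `transHom L E [x]`; hence
  **`inv_inflG_eq_classInvAll_baseCup_of_hinv`**: the layer pairing value of `φ` (vector `[x]`, `x` an idèle of `L`) at the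
  trace layer of `E` is door-c6's `inv_{E/L}(ι[x] ∪ β_m[galCharacterS χ])` — the left-hand side of door-c6 g14's dictionary.
* §3 **`classInvAll_baseCup_eq_zero_of_forall_layer_value_eq_zero_S`**: if all trace-layer values of `φ` vanish, then
  `inv_{K'/L}(ι[x] ∪ β_m[χ']) = 0` for every finite ABELIAN `K' ⊆ L̄` UNRAMIFIED OUTSIDE the primes `T` of `L` above `S`
  (embed `K'` into a layer `M ⊆ K_S` over `L`: `GalLayer.exists_ge_insideKS_nonempty_algHom`, the `S`-version of door-c4 g17's
  embedding, with the tower lemma `isUnramifiedIn_of_isUnramifiedIn_tower`; move the value to `M` by door-c6's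
  `classInvAll_baseCup_bockstein_comp`).
* §4 **`exists_nsmul_eq_of_forall_layer_value_eq_zero_S`** — MILNE'S (b), INJECTIVITY, for `(↥V̄_L, Res C̄_S)`: such a `φ`
  is `m • φ₂`.  By §3 and `forall_unramified_layer_pairing_eq_zero_iff_mk_mem_pow_sup_unitIdelesOutside` (global reciprocity
  with restricted ramification over the base `L`, file `GlobalReciprocityModPowersUnramifiedLayers`) the class of `x` lies in
  `C_Lᵐ · Ū_L^T`; and `Ū_L^T = U_{L,S}` (`unitIdelesOff_eq_unitIdelesOutside`) dies in `C̄_S` (`ofLayerS_eq_zero_iff`), so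
  `φ(1) = m • [c]` and `φ₂` is the invariant vector `[c]` (door-c4 `homTrivEquiv`).

Cell `bsd-eis`, background lane «PT-Ш-S-TC» of crux `GoodLatticeBDPValue` (stmt-BirchSwinnertonDyer-19032), brick D2-(b)
(`adjointBijective_one_zmod_pow` for `(G_S, C̄_S)`), seat bsd-line-x1-p1-w8 g12.  HONEST FRAMING: this is the `Hinj` input of
door-c4 g16's `adjointBijective_triv_zmod_of_cofinal` for the `S`-idèle class formation; no duality theorem, no case of
Poitou–Tate and no case of BSD is proved here.

## References
* J. S. Milne, *Arithmetic Duality Theorems* (2nd ed. 2006), I §1 Lemma 1.7, Theorem 1.8 (b); I §4. [MilneADT2006]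
* D. Harari, *Galois Cohomology and Class Field Theory*, Universitext (2020), §17.1 Theorem 17.2. [Harari2020]
* J. W. S. Cassels, A. Fröhlich (eds.), *Algebraic Number Theory* (1967), Ch. VII (J. Tate) §8, §11.3. [CasselsFrohlichANT1967]
* J. Neukirch, *Algebraic Number Theory* (1999), Ch. VI (7.3). [NeukirchANT1999]
* K. S. Brown, *Cohomology of Groups* (1982), III §8. [Brown1982CohomologyGroups]
-/

noncomputable section

open NumberField IsDedekindDomain CategoryTheory CategoryTheory.Limits groupCohomology
open Field (absoluteGaloisGroup)
open Literature.NumberTheory.Automorphic Literature.NumberTheory.Automorphic.IdeleClassGroup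
open Literature.NumberTheory.NumberFields
open Literature.Algebra.Homology Literature.Algebra.Homology.DiscreteRep
open Literature.NumberTheory.GaloisRepresentations.LocalWeilDatum (galFixing)
open scoped Classical

namespace Literature.NumberTheory.GaloisRepresentations

namespace IdeleClassBar

variable {K : Type} [Field K] [NumberField K] (S : Finset (HeightOneSpectrum (𝓞 K))) {L E : GalLayer K}

/-! ## §1. `g_S : Gal(E/L) ≃* ↥V̄_L ⧸ (V̄_E ∩ V̄_L)` and the characters `χ ∘ g_S` -/

/-- **`g_S : Gal(E/L) ≃* ↥V̄_L ⧸ (V̄_E ∩ V̄_L)`** (door-c4's `galEquivSubgroupImage` then `e⁻¹` of the values file); its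
underlying homomorphism is `galToTraceQuotS`. [cite: CasselsFrohlichANT1967, Ch. VII §11.3] -/
def galTraceQuotEquivS (h : L ≤ E) (hE : ramificationSubgroup K (↑S : Set (HeightOneSpectrum (𝓞 K))) ≤ galFixing K E.1) :
    (letI := GalLayer.algebraOfLE h; (E.1 ≃ₐ[L.1] E.1)) ≃*
      ((layerSubgroupS S L : Subgroup (GaloisGroupUnramifiedOutside K (↑S : Set (HeightOneSpectrum (𝓞 K))))) ⧸
        (DiscreteRep.traceOpenNormalSubgroup
            (layerSubgroupS S L : Subgroup (GaloisGroupUnramifiedOutside K (↑S : Set (HeightOneSpectrum (𝓞 K)))))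
                (layerSubgroupS S E) :
          Subgroup (layerSubgroupS S L : Subgroup (GaloisGroupUnramifiedOutside K (↑S : Set (HeightOneSpectrum (𝓞 K))))))) :=
  (galEquivSubgroupImage h).trans (traceQuotEquivSubgroupImage S L hE).symm

/-- `galTraceQuotEquivS` is `galToTraceQuotS` on elements. [cite: CasselsFrohlichANT1967, Ch. VII §11.3] -/
@[simp]
theorem galTraceQuotEquivS_apply (h : L ≤ E) (hE : ramificationSubgroup K (↑S : Set (HeightOneSpectrum
    (𝓞 K))) ≤ galFixing K E.1)
    (σ : letI := GalLayer.algebraOfLE h; (E.1 ≃ₐ[L.1] E.1)) :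
    galTraceQuotEquivS S h hE σ = galToTraceQuotS S h hE σ := rfl

/-- **The character `[χ] ∘ g_S : Gal(E/L) → ℤ/m`** of a class `χ ∈ H¹(↥V̄_L ⧸ (V̄_E ∩ V̄_L), ℤ/m)` (Mathlib `H1IsoOfIsTrivial`,
pulled back along `g_S`). [cite: Brown1982CohomologyGroups, III §8] -/
def galCharacterS (h : L ≤ E) (hE : ramificationSubgroup K (↑S : Set (HeightOneSpectrum (𝓞 K))) ≤ galFixing K E.1) {m : ℕ}
    (χ : groupCohomology (Rep.trivial ℤ ((layerSubgroupS S L : Subgroup (GaloisGroupUnramifiedOutside K (↑S : Set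
        (HeightOneSpectrum (𝓞 K))))) ⧸
        (DiscreteRep.traceOpenNormalSubgroup
            (layerSubgroupS S L : Subgroup (GaloisGroupUnramifiedOutside K (↑S : Set (HeightOneSpectrum (𝓞 K)))))
                (layerSubgroupS S E) :
          Subgroup (layerSubgroupS S L : Subgroup (GaloisGroupUnramifiedOutside K (↑S : Set (HeightOneSpectrum (𝓞 K)))))))
              (ZMod m)) 1) :
    Additive (letI := GalLayer.algebraOfLE h; (E.1 ≃ₐ[L.1] E.1)) →+ ZMod m :=
  ((H1IsoOfIsTrivial (Rep.trivial ℤ _ (ZMod m))).hom χ :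
      Additive ((layerSubgroupS S L : Subgroup (GaloisGroupUnramifiedOutside K (↑S : Set (HeightOneSpectrum (𝓞 K))))) ⧸
        (DiscreteRep.traceOpenNormalSubgroup
            (layerSubgroupS S L : Subgroup (GaloisGroupUnramifiedOutside K (↑S : Set (HeightOneSpectrum (𝓞 K)))))
                (layerSubgroupS S E) :
          Subgroup (layerSubgroupS S L : Subgroup (GaloisGroupUnramifiedOutside K (↑S : Set (HeightOneSpectrum
              (𝓞 K))))))) →+ ZMod m).comp
    (MonoidHom.toAdditive (galToTraceQuotS S h hE))

/-- **The class `[χ₀ ∘ g_S⁻¹] ∈ H¹(↥V̄_L ⧸ (V̄_E ∩ V̄_L), ℤ/m)` of a character `χ₀ : Gal(E/L) → ℤ/m`**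
    (inverse to `galCharacterS`).
[cite: Brown1982CohomologyGroups, III §8] -/
def traceCharacterS (h : L ≤ E) (hE : ramificationSubgroup K (↑S : Set (HeightOneSpectrum (𝓞 K))) ≤ galFixing K E.1) {m : ℕ}
    (χ₀ : Additive (letI := GalLayer.algebraOfLE h; (E.1 ≃ₐ[L.1] E.1)) →+ ZMod m) :
    groupCohomology (Rep.trivial ℤ ((layerSubgroupS S L : Subgroup (GaloisGroupUnramifiedOutside K (↑S : Set
        (HeightOneSpectrum (𝓞 K))))) ⧸
        (DiscreteRep.traceOpenNormalSubgroup
            (layerSubgroupS S L : Subgroup (GaloisGroupUnramifiedOutside K (↑S : Set (HeightOneSpectrum (𝓞 K)))))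
                (layerSubgroupS S E) :
          Subgroup (layerSubgroupS S L : Subgroup (GaloisGroupUnramifiedOutside K (↑S : Set (HeightOneSpectrum (𝓞 K)))))))
              (ZMod m)) 1 :=
  (H1IsoOfIsTrivial (Rep.trivial ℤ _ (ZMod m))).inv
    (χ₀.comp (MonoidHom.toAdditive (galTraceQuotEquivS S h hE).symm.toMonoidHom))

/-- `galCharacterS (traceCharacterS χ₀) = χ₀`: every character of `Gal(E/L)` is a `[χ] ∘ g_S`.
[cite: Brown1982CohomologyGroups, III §8] -/
theorem galCharacterS_traceCharacterS (h : L ≤ E)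
    (hE : ramificationSubgroup K (↑S : Set (HeightOneSpectrum (𝓞 K))) ≤ galFixing K E.1) {m : ℕ}
    (χ₀ : Additive (letI := GalLayer.algebraOfLE h; (E.1 ≃ₐ[L.1] E.1)) →+ ZMod m) :
    galCharacterS S h hE (traceCharacterS S h hE χ₀) = χ₀ := by
  rw [galCharacterS, traceCharacterS, Iso.inv_hom_id_apply]
  refine AddMonoidHom.ext fun σ => ?_
  change χ₀ (Additive.ofMul ((galTraceQuotEquivS S h hE).symm (galToTraceQuotS S h hE (Additive.toMul σ)))) = χ₀ σ
  rw [← galTraceQuotEquivS_apply, MulEquiv.symm_apply_apply]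
  rfl

set_option maxHeartbeats 800000 in
-- the final `assumption` unifies `(intModShortComplex _ m).X₃` / `galCharacterS` against their unfolded forms
/-- **`H¹(g_S, 𝟙) χ = [galCharacterS χ]`**
    (door-c6 `Bockstein.map_H1IsoOfIsTrivial_inv_comp`). [cite: Brown1982CohomologyGroups, III §8] -/
theorem map_galToTraceQuotS_eq_H1IsoOfIsTrivial_inv (h : L ≤ E)
    (hE : ramificationSubgroup K (↑S : Set (HeightOneSpectrum (𝓞 K))) ≤ galFixing K E.1) {m : ℕ}
    (χ : groupCohomology (Rep.trivial ℤ ((layerSubgroupS S L : Subgroup (GaloisGroupUnramifiedOutside K (↑S : Set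
        (HeightOneSpectrum (𝓞 K))))) ⧸
        (DiscreteRep.traceOpenNormalSubgroup
            (layerSubgroupS S L : Subgroup (GaloisGroupUnramifiedOutside K (↑S : Set (HeightOneSpectrum (𝓞 K)))))
                (layerSubgroupS S E) :
          Subgroup (layerSubgroupS S L : Subgroup (GaloisGroupUnramifiedOutside K (↑S : Set (HeightOneSpectrum (𝓞 K)))))))
              (ZMod m)) 1) :
    (groupCohomology.map (galToTraceQuotS S h hE) (𝟙 (Rep.trivial ℤ _ (ZMod m))) 1 χ :
        groupCohomology (Bockstein.intModShortComplex (letI := GalLayer.algebraOfLE h; (E.1 ≃ₐ[L.1] E.1)) m).X₃ 1) =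
      (H1IsoOfIsTrivial (Rep.trivial ℤ (letI := GalLayer.algebraOfLE h; (E.1 ≃ₐ[L.1] E.1)) (ZMod m))).inv
        (galCharacterS S h hE χ) := by
  have key := Bockstein.map_H1IsoOfIsTrivial_inv_comp (galToTraceQuotS S h hE)
    ((H1IsoOfIsTrivial (Rep.trivial ℤ _ (ZMod m))).hom χ :
      Additive ((layerSubgroupS S L : Subgroup (GaloisGroupUnramifiedOutside K (↑S : Set (HeightOneSpectrum (𝓞 K))))) ⧸
        (DiscreteRep.traceOpenNormalSubgroup
            (layerSubgroupS S L : Subgroup (GaloisGroupUnramifiedOutside K (↑S : Set (HeightOneSpectrum (𝓞 K)))))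
                (layerSubgroupS S E) :
          Subgroup (layerSubgroupS S L : Subgroup (GaloisGroupUnramifiedOutside K (↑S : Set (HeightOneSpectrum
              (𝓞 K))))))) →+ ZMod m)
  rwa [Iso.hom_inv_id_apply] at key

/-! ## §2. The vector `c_E = ι[x]` and the value as door-c6's cup product `inv_{E/L}(ι[x] ∪ β_m[χ ∘ g_S])` -/

/-- **`ι[x] = (transHom L E) [x]`**: door-c6's `Gal(E/L)`-invariant vector `baseInvariant x ∈ C_E` of an idèle `x` of `L` is
door-c5's base change of the class `[x] ∈ C_L` (`transHom_eq_baseChangeHom`, `coe_baseInvariant`).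
[cite: CasselsFrohlichANT1967, Ch. VII §8 Prop. 8.1] -/
theorem coe_baseInvariant_eq_transHom (h : L ≤ E) (x : haveI := L.numberField; ideleGroup L.1) :
    letI := GalLayer.algebraOfLE h; haveI := GalLayer.isScalarTower_of_le h; haveI := L.numberField;
    haveI := E.numberField; haveI := E.isGalois; haveI : IsGalois L.1 E.1 := IsGalois.tower_top_of_isGalois K L.1 E.1;
    ((IdeleCohomology.baseInvariant (E := E.1) x : (IdeleClassGroup.galoisRep L.1 E.1).ρ.invariants) :
        (IdeleClassGroup.galoisRep L.1 E.1).V) =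
      transHom L E h (Additive.ofMul (x : IdeleClassGroup L.1)) := by
  haveI := L.numberField
  haveI := E.numberField
  rw [transHom_eq_baseChangeHom]
  rfl

/-- Congruence for door-c6's `smulHom` in its vector argument (the invariance proof is irrelevant).
[cite: CasselsFrohlichANT1967, Ch. VII §11.3] -/
private theorem smulHom_congr {G : Type} [Group G] [Fintype G] (A : Rep ℤ G) {v v' : A.V} (hv : v = v')
    (h : ∀ g, A.ρ g v = v) (h' : ∀ g, A.ρ g v' = v') : Unramified.smulHom A v h = Unramified.smulHom A v' h' := by
  subst hv
  rfl

set_option maxHeartbeats 800000 in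
-- one rewrite with the values file's dictionary inside the large unfolded layer terms (cf. the template's §28)
/-- **`inv (Inf (H²(id, φ_V) (β_m χ))) = inv_{E/L}(ι[x] ∪ β_m[χ ∘ g_S])`**: for `inv` satisfying `hinv` at the layer `E ⊇ L`,
`φ : ℤ ⟶ Res_{V̄_L} C̄_S` with vector the class of an idèle `x` of `L`, and `χ ∈ H¹(↥V̄_L ⧸
    (V̄_E ∩ V̄_L), ℤ/m)`, the layer pairing
value is door-c6's `classInvAll L E (baseCup x (β_m [galCharacterS χ]))` — the left-hand side of door-c6 g14's
`classInvAll_baseCup_bockstein_*`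
    (`= −χ₀(ψ_{E/L} x)/m`). [cite: CasselsFrohlichANT1967, Ch. VII §11.3][cite: MilneADT2006, I Theorem 1.8 (b)] -/
theorem inv_inflG_eq_classInvAll_baseCup_of_hinv (h : L ≤ E)
    (hL : ramificationSubgroup K (↑S : Set (HeightOneSpectrum (𝓞 K))) ≤ galFixing K L.1)
    (hE : ramificationSubgroup K (↑S : Set (HeightOneSpectrum (𝓞 K))) ≤ galFixing K E.1)
    (hSE : ∀ v : HeightOneSpectrum (𝓞 K), v ∉ S → (haveI := E.numberField; Algebra.IsUnramifiedIn (𝓞 E.1) v.asIdeal))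
    {m : ℕ} (hm : 0 < m)
    (inv : Abelian.Ext (triv (k := ℤ) (Γ := (layerSubgroupS S L : Subgroup (GaloisGroupUnramifiedOutside K (↑S : Set
        (HeightOneSpectrum (𝓞 K)))))) ℤ)
      ((resD ℤ (layerSubgroupS S L : Subgroup (GaloisGroupUnramifiedOutside K (↑S : Set (HeightOneSpectrum (𝓞 K)))))).obj
        (classBarSD K S)) 2 →+ AddCircle (1 : ℚ))
    (hinv : ∀ x : groupCohomology (relLayerRepS S (layerSubgroupS S L : Subgroup (GaloisGroupUnramifiedOutside K (↑S : Set
        (HeightOneSpectrum (𝓞 K))))) E) 2,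
      inv (LayerColimit.inflG (DiscreteRep.traceOpenNormalSubgroup (layerSubgroupS S L : Subgroup
          (GaloisGroupUnramifiedOutside K (↑S : Set (HeightOneSpectrum (𝓞 K))))) (layerSubgroupS S E))
          ((resD ℤ (layerSubgroupS S L : Subgroup (GaloisGroupUnramifiedOutside K (↑S : Set (HeightOneSpectrum (𝓞 K)))))).obj
              (classBarSD K S)) 2 x) =
        (haveI := E.numberField; haveI := E.isGalois; haveI := finite_gal K E;
          (IdeleCohomology.isClassModule_classModUnitsCocycle S hSE).invSub
            (subgroupImageS S hE (layerSubgroupS S L : Subgroup (GaloisGroupUnramifiedOutside K (↑S : Set (HeightOneSpectrum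
                (𝓞 K))))))
            ((relLayerSCohomologyIso S hE (layerSubgroupS_anti S h) 2).hom x)))
    (φ : triv (k := ℤ) (Γ := (layerSubgroupS S L : Subgroup (GaloisGroupUnramifiedOutside K (↑S : Set (HeightOneSpectrum
        (𝓞 K)))))) ℤ ⟶
      (resD ℤ (layerSubgroupS S L : Subgroup (GaloisGroupUnramifiedOutside K (↑S : Set (HeightOneSpectrum (𝓞 K)))))).obj
        (classBarSD K S))
    (x : haveI := L.numberField; ideleGroup L.1)
    (hx : haveI := L.numberField; ofLayerS S hL (Additive.ofMul (x : IdeleClassGroup L.1)) = φ.hom.hom (1 : ℤ))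
    (χ : groupCohomology (Rep.trivial ℤ ((layerSubgroupS S L : Subgroup (GaloisGroupUnramifiedOutside K (↑S : Set
        (HeightOneSpectrum (𝓞 K))))) ⧸
        (DiscreteRep.traceOpenNormalSubgroup
            (layerSubgroupS S L : Subgroup (GaloisGroupUnramifiedOutside K (↑S : Set (HeightOneSpectrum (𝓞 K)))))
                (layerSubgroupS S E) :
          Subgroup (layerSubgroupS S L : Subgroup (GaloisGroupUnramifiedOutside K (↑S : Set (HeightOneSpectrum (𝓞 K)))))))
              (ZMod m)) 1) :
    haveI : NeZero m := ⟨hm.ne'⟩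
    inv (LayerColimit.inflG (DiscreteRep.traceOpenNormalSubgroup (layerSubgroupS S L : Subgroup
        (GaloisGroupUnramifiedOutside K (↑S : Set (HeightOneSpectrum (𝓞 K))))) (layerSubgroupS S E))
        ((resD ℤ (layerSubgroupS S L : Subgroup (GaloisGroupUnramifiedOutside K (↑S : Set (HeightOneSpectrum (𝓞 K)))))).obj
            (classBarSD K S)) 2
        (groupCohomology.map (MonoidHom.id _)
          (LayerColimit.homToLayer (DiscreteRep.traceOpenNormalSubgroup (layerSubgroupS S L : Subgroup
              (GaloisGroupUnramifiedOutside K (↑S : Set (HeightOneSpectrum (𝓞 K))))) (layerSubgroupS S E) : Subgroup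
              (layerSubgroupS S L : Subgroup (GaloisGroupUnramifiedOutside K (↑S : Set (HeightOneSpectrum (𝓞 K))))))
            ((resD ℤ (layerSubgroupS S L : Subgroup (GaloisGroupUnramifiedOutside K (↑S : Set (HeightOneSpectrum
                (𝓞 K)))))).obj (classBarSD K S)) φ) 2
          (groupCohomology.δ (Bockstein.intModShortComplex_shortExact ((layerSubgroupS S L : Subgroup
              (GaloisGroupUnramifiedOutside K (↑S : Set (HeightOneSpectrum (𝓞 K))))) ⧸
        (DiscreteRep.traceOpenNormalSubgroup
            (layerSubgroupS S L : Subgroup (GaloisGroupUnramifiedOutside K (↑S : Set (HeightOneSpectrum (𝓞 K)))))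
                (layerSubgroupS S E) :
          Subgroup (layerSubgroupS S L : Subgroup (GaloisGroupUnramifiedOutside K (↑S : Set (HeightOneSpectrum
              (𝓞 K))))))) m) 1 2 rfl χ))) =
      (letI := GalLayer.algebraOfLE h; haveI := GalLayer.isScalarTower_of_le h; haveI := L.numberField;
    haveI := E.numberField; haveI := E.isGalois; haveI : IsGalois L.1 E.1 := IsGalois.tower_top_of_isGalois K L.1 E.1;
        IdeleCohomology.classInvAll L.1 E.1
          (IdeleCohomology.baseCup (E := E.1) x
            (groupCohomology.δ (Bockstein.intModShortComplex_shortExact (E.1 ≃ₐ[L.1] E.1) m) 1 2 rfl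
              ((H1IsoOfIsTrivial (Rep.trivial ℤ (E.1 ≃ₐ[L.1] E.1) (ZMod m))).inv (galCharacterS S h hE χ))))) := by
  haveI : NeZero m := ⟨hm.ne'⟩
  letI := GalLayer.algebraOfLE h
  haveI := GalLayer.isScalarTower_of_le h
  haveI := L.numberField
  haveI := E.numberField
  haveI := E.isGalois
  haveI : IsGalois L.1 E.1 := IsGalois.tower_top_of_isGalois K L.1 E.1
  rw [inv_inflG_eq_classInvAll_of_hinv S h hL hE hSE hm inv hinv φ hx χ, map_galToTraceQuotS_eq_H1IsoOfIsTrivial_inv S h hE χ,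
    smulHom_congr (IdeleClassGroup.galoisRep L.1 E.1) (coe_baseInvariant_eq_transHom h x).symm
      (galoisRep_ρ_transHom h _) (fun g => (IdeleCohomology.baseInvariant (E := E.1) x).2 g)]
  rfl

/-! ## §3. All trace-layer values vanish ⟹ `inv_{K'/L}(ι[x] ∪ β_m[χ']) = 0` for `K'/L` abelian, unramified outside `S` -/

/-- The primes of `L` outside the set `T` of primes above `S` lie above primes of `K` outside `S`; so an extension of `L`
unramified outside `T` is, as an extension of `K`, unramified outside `S` (`L ⊆ K_S` is unramified outside `S`; tower lemma
`isUnramifiedIn_of_isUnramifiedIn_tower`). [cite: NeukirchANT1999, Ch. VI (7.3)] -/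
theorem isUnramifiedIn_of_forall_not_mem_above (hL : ramificationSubgroup K (↑S : Set (HeightOneSpectrum
    (𝓞 K))) ≤ galFixing K L.1)
    (T : haveI := L.numberField; Finset (HeightOneSpectrum (𝓞 L.1)))
    (hT : haveI := L.numberField; ∀ w : HeightOneSpectrum (𝓞 L.1), w ∈ T ↔ w.under (𝓞 K) ∈ S)
    (K' : Type) [Field K'] [NumberField K'] [Algebra L.1 K'] [Algebra K K'] [IsScalarTower K L.1 K']
    (hunr : haveI := L.numberField;
      ∀ w : HeightOneSpectrum (𝓞 L.1), w ∉ T → Algebra.IsUnramifiedIn (𝓞 K') w.asIdeal)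
    {v : HeightOneSpectrum (𝓞 K)} (hv : v ∉ S) : Algebra.IsUnramifiedIn (𝓞 K') v.asIdeal := by
  haveI := L.numberField
  refine isUnramifiedIn_of_isUnramifiedIn_tower (K := K) L.1 K' v
    (GalLayer.isUnramifiedIn_of_insideKS (S := (↑S : Set (HeightOneSpectrum (𝓞 K)))) L hL fun hv' => hv (Finset.mem_coe.1 hv'))
    fun w hw => hunr w fun hwT => hv ?_
  have hwv : w.under (𝓞 K) = v :=
    HeightOneSpectrum.ext (by rw [HeightOneSpectrum.under_asIdeal]; exact hw.over.symm)
  rw [← hwv]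
  exact (hT w).1 hwT

set_option synthInstance.maxHeartbeats 100000 in
set_option maxHeartbeats 800000 in
-- instance synthesis over `K' ⊆ L̄` (an intermediate field of the algebraic closure of a layer) is slow (cf. the template's §32)
/-- **Every `inv_{K'/L}(ι[x] ∪ β_m[χ'])` (`K'/L` finite abelian, unramified outside the primes `T` above `S`) vanishes when
the trace-layer values of `φ` do**, for the idèle `x` of `L` representing `φ(1) ∈ C̄_S^{V̄_L}`: embed `K'` over `L` into a
layer `M ⊆ K_S`, `M ⊇ L`
    (`GalLayer.exists_ge_insideKS_nonempty_algHom`), move the value to `M` by door-c6's inflation invariance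
(`classInvAll_baseCup_bockstein_comp`), and read it there as a layer pairing value of `φ` (§2).
[cite: CasselsFrohlichANT1967, Ch. VII §11.3][cite: MilneADT2006, I Theorem 1.8 (b)][cite: NeukirchANT1999, Ch. VI (7.3)] -/
theorem classInvAll_baseCup_eq_zero_of_forall_layer_value_eq_zero_S
    (hL : ramificationSubgroup K (↑S : Set (HeightOneSpectrum (𝓞 K))) ≤ galFixing K L.1) {m : ℕ} (hm : 0 < m)
    (inv : Abelian.Ext (triv (k := ℤ) (Γ := (layerSubgroupS S L : Subgroup (GaloisGroupUnramifiedOutside K (↑S : Set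
        (HeightOneSpectrum (𝓞 K)))))) ℤ)
      ((resD ℤ (layerSubgroupS S L : Subgroup (GaloisGroupUnramifiedOutside K (↑S : Set (HeightOneSpectrum (𝓞 K)))))).obj
        (classBarSD K S)) 2 →+ AddCircle (1 : ℚ))
    (hinv : ∀ (E : GalLayer K) (hE : ramificationSubgroup K (↑S : Set (HeightOneSpectrum (𝓞 K))) ≤ galFixing K E.1)
      (hSE : ∀ v : HeightOneSpectrum (𝓞 K), v ∉ S → (haveI := E.numberField; Algebra.IsUnramifiedIn (𝓞 E.1) v.asIdeal))
      (h : L ≤ E) (x : groupCohomology (relLayerRepS S (layerSubgroupS S L : Subgroup (GaloisGroupUnramifiedOutside K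
          (↑S : Set (HeightOneSpectrum (𝓞 K))))) E) 2),
      inv (LayerColimit.inflG (DiscreteRep.traceOpenNormalSubgroup (layerSubgroupS S L : Subgroup
          (GaloisGroupUnramifiedOutside K (↑S : Set (HeightOneSpectrum (𝓞 K))))) (layerSubgroupS S E))
          ((resD ℤ (layerSubgroupS S L : Subgroup (GaloisGroupUnramifiedOutside K (↑S : Set (HeightOneSpectrum (𝓞 K)))))).obj
              (classBarSD K S)) 2 x) =
        (haveI := E.numberField; haveI := E.isGalois; haveI := finite_gal K E;
          (IdeleCohomology.isClassModule_classModUnitsCocycle S hSE).invSub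
            (subgroupImageS S hE (layerSubgroupS S L : Subgroup (GaloisGroupUnramifiedOutside K (↑S : Set (HeightOneSpectrum
                (𝓞 K))))))
            ((relLayerSCohomologyIso S hE (layerSubgroupS_anti S h) 2).hom x)))
    (φ : triv (k := ℤ) (Γ := (layerSubgroupS S L : Subgroup (GaloisGroupUnramifiedOutside K (↑S : Set (HeightOneSpectrum
        (𝓞 K)))))) ℤ ⟶
      (resD ℤ (layerSubgroupS S L : Subgroup (GaloisGroupUnramifiedOutside K (↑S : Set (HeightOneSpectrum (𝓞 K)))))).obj
        (classBarSD K S))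
    (H : ∀ (E : GalLayer K) (hE : ramificationSubgroup K (↑S : Set (HeightOneSpectrum (𝓞 K))) ≤ galFixing K E.1) (h : L ≤ E)
      (χ : groupCohomology (Rep.trivial ℤ ((layerSubgroupS S L : Subgroup (GaloisGroupUnramifiedOutside K (↑S : Set
          (HeightOneSpectrum (𝓞 K))))) ⧸
        (DiscreteRep.traceOpenNormalSubgroup
            (layerSubgroupS S L : Subgroup (GaloisGroupUnramifiedOutside K (↑S : Set (HeightOneSpectrum (𝓞 K)))))
                (layerSubgroupS S E) :
          Subgroup (layerSubgroupS S L : Subgroup (GaloisGroupUnramifiedOutside K (↑S : Set (HeightOneSpectrum (𝓞 K)))))))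
              (ZMod m)) 1),
      haveI : NeZero m := ⟨hm.ne'⟩
      inv (LayerColimit.inflG (DiscreteRep.traceOpenNormalSubgroup (layerSubgroupS S L : Subgroup
          (GaloisGroupUnramifiedOutside K (↑S : Set (HeightOneSpectrum (𝓞 K))))) (layerSubgroupS S E))
        ((resD ℤ (layerSubgroupS S L : Subgroup (GaloisGroupUnramifiedOutside K (↑S : Set (HeightOneSpectrum (𝓞 K)))))).obj
            (classBarSD K S)) 2
        (groupCohomology.map (MonoidHom.id _)
          (LayerColimit.homToLayer (DiscreteRep.traceOpenNormalSubgroup (layerSubgroupS S L : Subgroup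
              (GaloisGroupUnramifiedOutside K (↑S : Set (HeightOneSpectrum (𝓞 K))))) (layerSubgroupS S E) : Subgroup
              (layerSubgroupS S L : Subgroup (GaloisGroupUnramifiedOutside K (↑S : Set (HeightOneSpectrum (𝓞 K))))))
            ((resD ℤ (layerSubgroupS S L : Subgroup (GaloisGroupUnramifiedOutside K (↑S : Set (HeightOneSpectrum
                (𝓞 K)))))).obj (classBarSD K S)) φ) 2
          (groupCohomology.δ (Bockstein.intModShortComplex_shortExact ((layerSubgroupS S L : Subgroup
              (GaloisGroupUnramifiedOutside K (↑S : Set (HeightOneSpectrum (𝓞 K))))) ⧸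
        (DiscreteRep.traceOpenNormalSubgroup
            (layerSubgroupS S L : Subgroup (GaloisGroupUnramifiedOutside K (↑S : Set (HeightOneSpectrum (𝓞 K)))))
                (layerSubgroupS S E) :
          Subgroup (layerSubgroupS S L : Subgroup (GaloisGroupUnramifiedOutside K (↑S : Set (HeightOneSpectrum
              (𝓞 K))))))) m) 1 2 rfl χ))) = 0)
    (x : haveI := L.numberField; ideleGroup L.1)
    (hx : haveI := L.numberField; ofLayerS S hL (Additive.ofMul (x : IdeleClassGroup L.1)) = φ.hom.hom (1 : ℤ))
    (T : haveI := L.numberField; Finset (HeightOneSpectrum (𝓞 L.1)))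
    (hT : haveI := L.numberField; ∀ w : HeightOneSpectrum (𝓞 L.1), w ∈ T ↔ w.under (𝓞 K) ∈ S)
    (K' : haveI := L.numberField; IntermediateField L.1 (AlgebraicClosure L.1))
    (hK : haveI := L.numberField; FiniteDimensional L.1 K') (hab : haveI := L.numberField; IsAbelianGalois L.1 K')
    (hunr : haveI := L.numberField; haveI : NumberField K' := NumberField.of_module_finite L.1 K';
      ∀ w : HeightOneSpectrum (𝓞 L.1), w ∉ T → Algebra.IsUnramifiedIn (𝓞 K') w.asIdeal)
    (χK : haveI := L.numberField; Additive (K' ≃ₐ[L.1] K') →+ ZMod m) :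
    haveI := L.numberField; haveI : NumberField K' := NumberField.of_module_finite L.1 K'; haveI : NeZero m := ⟨hm.ne'⟩
    IdeleCohomology.classInvAll L.1 K' (IdeleCohomology.baseCup (E := K') x
      (groupCohomology.δ (Bockstein.intModShortComplex_shortExact (K' ≃ₐ[L.1] K') m) 1 2 rfl
        ((H1IsoOfIsTrivial (Rep.trivial ℤ (K' ≃ₐ[L.1] K') (ZMod m))).inv χK))) = 0 := by
  haveI : NeZero m := ⟨hm.ne'⟩
  haveI := L.numberField
  haveI := hK
  haveI := hab
  haveI : NumberField K' := NumberField.of_module_finite L.1 K'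
  -- `K'/K` is unramified outside `S`
  have hK'S : ∀ v : HeightOneSpectrum (𝓞 K), v ∉ (↑S : Set (HeightOneSpectrum (𝓞 K))) →
      Algebra.IsUnramifiedIn (𝓞 K') v.asIdeal := fun v hv =>
    isUnramifiedIn_of_forall_not_mem_above S hL T hT K' hunr fun hv' => hv (Finset.mem_coe.2 hv')
  -- a layer `M ⊇ L` inside `K_S` containing `K'` over `L` (`Exists.elim`, not `obtain`, as in the template's §32)
  have hex := GalLayer.exists_ge_insideKS_nonempty_algHom (S := (↑S : Set (HeightOneSpectrum (𝓞 K)))) L hL K' hK'S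
  refine hex.elim fun M hM => hM.elim fun hLM hrest => hrest.2.elim fun ψ => ?_
  have hMS : ramificationSubgroup K (↑S : Set (HeightOneSpectrum (𝓞 K))) ≤ galFixing K M.1 := hrest.1
  clear hM hex
  letI := GalLayer.algebraOfLE hLM
  haveI := GalLayer.isScalarTower_of_le hLM
  haveI := M.numberField
  haveI := M.isGalois
  haveI : IsGalois L.1 M.1 := IsGalois.tower_top_of_isGalois K L.1 M.1
  have hSM : ∀ v : HeightOneSpectrum (𝓞 K), v ∉ S → Algebra.IsUnramifiedIn (𝓞 M.1) v.asIdeal := fun v hv =>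
    GalLayer.isUnramifiedIn_of_insideKS (S := (↑S : Set (HeightOneSpectrum (𝓞 K)))) M hMS fun hv' => hv (Finset.mem_coe.1 hv')
  -- the layer value at `M` for the character `χ' ∘ res` (before the instances of `K'` over `M` enter the context)
  have hval := fun (χ : groupCohomology (Rep.trivial ℤ ((layerSubgroupS S L : Subgroup (GaloisGroupUnramifiedOutside K
      (↑S : Set (HeightOneSpectrum (𝓞 K))))) ⧸
        (DiscreteRep.traceOpenNormalSubgroup
            (layerSubgroupS S L : Subgroup (GaloisGroupUnramifiedOutside K (↑S : Set (HeightOneSpectrum (𝓞 K)))))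
                (layerSubgroupS S M) :
          Subgroup (layerSubgroupS S L : Subgroup (GaloisGroupUnramifiedOutside K (↑S : Set (HeightOneSpectrum (𝓞 K)))))))
              (ZMod m)) 1) =>
    inv_inflG_eq_classInvAll_baseCup_of_hinv S hLM hL hMS hSM hm inv (hinv M hMS hSM hLM) φ x hx χ
  -- move the value from `K'` to the layer `M` (door-c6's inflation invariance)
  letI : Algebra K' M.1 := ψ.toRingHom.toAlgebra
  haveI : IsScalarTower L.1 K' M.1 := IsScalarTower.of_algebraMap_eq fun r => (ψ.commutes r).symm
  rw [← IdeleCohomology.classInvAll_baseCup_bockstein_comp L.1 K' M.1 m χK x,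
    ← galCharacterS_traceCharacterS S hLM hMS (χK.comp (MonoidHom.toAdditive
        (AlgEquiv.restrictNormalHom (F := L.1) (K₁ := M.1) K'))), ← hval]
  exact H M hMS hLM _

/-! ## §4. Milne's (b), injectivity, for `(↥V̄_L, Res C̄_S)` -/

set_option maxHeartbeats 800000 in
-- the arithmetic over the base `L = ↥L.1` (an intermediate field of `K̄`) elaborates slowly (cf. the template's §32–§33)
/-- **Milne's (b) for `(↥V̄_L, Res C̄_S)`, injectivity side.**  Let `inv` satisfy `hinv` at every layer `E ⊇ L` inside `K_S`
(e.g. `inv = invAt (classBarSD K S) inv_S V̄_L`, bsd-line-x1-p1-w5's `invAt_classBarSD_inflG`).  If `φ : ℤ ⟶ Res_{V̄_L} C̄_S`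
pairs to zero with every character of every trace layer — `inv (Inf (H²(id, φ_V) (β_m χ))) = 0` for all layers `E ⊇ L` inside
`K_S` and all `χ ∈ H¹(↥V̄_L ⧸ (V̄_E ∩ V̄_L), ℤ/m)` — then `φ = m • φ₂`.  (The idèle class `[x] = φ(1)` pairs to zero with every
`β_m[χ']`, `K'/L` finite abelian unramified outside the primes above `S`, by §3; so `[x] ∈ C_Lᵐ · Ū_L^T` by global
reciprocity with restricted ramification (`forall_unramified_layer_pairing_eq_zero_iff_mk_mem_pow_sup_unitIdelesOutside`);
`Ū_L^T = U_{L,S}` dies in `C̄_S`, so `φ(1) = m • [c]` and `φ₂` is the invariant vector `[c]`, door-c4 `homTrivEquiv`.)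
[cite: MilneADT2006, I Theorem 1.8
    (b), §4][cite: Harari2020, §17.1 Theorem 17.2][cite: CasselsFrohlichANT1967, Ch. VII §11.3] -/
theorem exists_nsmul_eq_of_forall_layer_value_eq_zero_S
    (hL : ramificationSubgroup K (↑S : Set (HeightOneSpectrum (𝓞 K))) ≤ galFixing K L.1) {m : ℕ} (hm : 0 < m)
    (inv : Abelian.Ext (triv (k := ℤ) (Γ := (layerSubgroupS S L : Subgroup (GaloisGroupUnramifiedOutside K (↑S : Set
        (HeightOneSpectrum (𝓞 K)))))) ℤ)
      ((resD ℤ (layerSubgroupS S L : Subgroup (GaloisGroupUnramifiedOutside K (↑S : Set (HeightOneSpectrum (𝓞 K)))))).obj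
        (classBarSD K S)) 2 →+ AddCircle (1 : ℚ))
    (hinv : ∀ (E : GalLayer K) (hE : ramificationSubgroup K (↑S : Set (HeightOneSpectrum (𝓞 K))) ≤ galFixing K E.1)
      (hSE : ∀ v : HeightOneSpectrum (𝓞 K), v ∉ S → (haveI := E.numberField; Algebra.IsUnramifiedIn (𝓞 E.1) v.asIdeal))
      (h : L ≤ E) (x : groupCohomology (relLayerRepS S (layerSubgroupS S L : Subgroup (GaloisGroupUnramifiedOutside K
          (↑S : Set (HeightOneSpectrum (𝓞 K))))) E) 2),
      inv (LayerColimit.inflG (DiscreteRep.traceOpenNormalSubgroup (layerSubgroupS S L : Subgroup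
          (GaloisGroupUnramifiedOutside K (↑S : Set (HeightOneSpectrum (𝓞 K))))) (layerSubgroupS S E))
          ((resD ℤ (layerSubgroupS S L : Subgroup (GaloisGroupUnramifiedOutside K (↑S : Set (HeightOneSpectrum (𝓞 K)))))).obj
              (classBarSD K S)) 2 x) =
        (haveI := E.numberField; haveI := E.isGalois; haveI := finite_gal K E;
          (IdeleCohomology.isClassModule_classModUnitsCocycle S hSE).invSub
            (subgroupImageS S hE (layerSubgroupS S L : Subgroup (GaloisGroupUnramifiedOutside K (↑S : Set (HeightOneSpectrum
                (𝓞 K))))))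
            ((relLayerSCohomologyIso S hE (layerSubgroupS_anti S h) 2).hom x)))
    (φ : triv (k := ℤ) (Γ := (layerSubgroupS S L : Subgroup (GaloisGroupUnramifiedOutside K (↑S : Set (HeightOneSpectrum
        (𝓞 K)))))) ℤ ⟶
      (resD ℤ (layerSubgroupS S L : Subgroup (GaloisGroupUnramifiedOutside K (↑S : Set (HeightOneSpectrum (𝓞 K)))))).obj
        (classBarSD K S))
    (H : ∀ (E : GalLayer K) (hE : ramificationSubgroup K (↑S : Set (HeightOneSpectrum (𝓞 K))) ≤ galFixing K E.1) (h : L ≤ E)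
      (χ : groupCohomology (Rep.trivial ℤ ((layerSubgroupS S L : Subgroup (GaloisGroupUnramifiedOutside K (↑S : Set
          (HeightOneSpectrum (𝓞 K))))) ⧸
        (DiscreteRep.traceOpenNormalSubgroup
            (layerSubgroupS S L : Subgroup (GaloisGroupUnramifiedOutside K (↑S : Set (HeightOneSpectrum (𝓞 K)))))
                (layerSubgroupS S E) :
          Subgroup (layerSubgroupS S L : Subgroup (GaloisGroupUnramifiedOutside K (↑S : Set (HeightOneSpectrum (𝓞 K)))))))
              (ZMod m)) 1),
      haveI : NeZero m := ⟨hm.ne'⟩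
      inv (LayerColimit.inflG (DiscreteRep.traceOpenNormalSubgroup (layerSubgroupS S L : Subgroup
          (GaloisGroupUnramifiedOutside K (↑S : Set (HeightOneSpectrum (𝓞 K))))) (layerSubgroupS S E))
        ((resD ℤ (layerSubgroupS S L : Subgroup (GaloisGroupUnramifiedOutside K (↑S : Set (HeightOneSpectrum (𝓞 K)))))).obj
            (classBarSD K S)) 2
        (groupCohomology.map (MonoidHom.id _)
          (LayerColimit.homToLayer (DiscreteRep.traceOpenNormalSubgroup (layerSubgroupS S L : Subgroup
              (GaloisGroupUnramifiedOutside K (↑S : Set (HeightOneSpectrum (𝓞 K))))) (layerSubgroupS S E) : Subgroup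
              (layerSubgroupS S L : Subgroup (GaloisGroupUnramifiedOutside K (↑S : Set (HeightOneSpectrum (𝓞 K))))))
            ((resD ℤ (layerSubgroupS S L : Subgroup (GaloisGroupUnramifiedOutside K (↑S : Set (HeightOneSpectrum
                (𝓞 K)))))).obj (classBarSD K S)) φ) 2
          (groupCohomology.δ (Bockstein.intModShortComplex_shortExact ((layerSubgroupS S L : Subgroup
              (GaloisGroupUnramifiedOutside K (↑S : Set (HeightOneSpectrum (𝓞 K))))) ⧸
        (DiscreteRep.traceOpenNormalSubgroup
            (layerSubgroupS S L : Subgroup (GaloisGroupUnramifiedOutside K (↑S : Set (HeightOneSpectrum (𝓞 K)))))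
                (layerSubgroupS S E) :
          Subgroup (layerSubgroupS S L : Subgroup (GaloisGroupUnramifiedOutside K (↑S : Set (HeightOneSpectrum
              (𝓞 K))))))) m) 1 2 rfl χ))) = 0) :
    ∃ φ₂ : triv (k := ℤ) (Γ := (layerSubgroupS S L : Subgroup (GaloisGroupUnramifiedOutside K (↑S : Set (HeightOneSpectrum
        (𝓞 K)))))) ℤ ⟶
      (resD ℤ (layerSubgroupS S L : Subgroup (GaloisGroupUnramifiedOutside K (↑S : Set (HeightOneSpectrum (𝓞 K)))))).obj
          (classBarSD K S), m • φ₂ = φ := by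
  haveI : NeZero m := ⟨hm.ne'⟩
  haveI := L.numberField
  -- the class `c₀ ∈ C_L` of `φ` and an idèle `x₀` representing it
  obtain ⟨c₀, hc₀⟩ := exists_ofLayerS_eq_hom_one S hL φ
  obtain ⟨x₀, hx₀⟩ := QuotientGroup.mk_surjective (Additive.toMul c₀)
  have hx₀' : ofLayerS S hL (Additive.ofMul (x₀ : IdeleClassGroup L.1)) = φ.hom.hom (1 : ℤ) := by
    rw [hx₀]
    exact hc₀
  -- the primes `T` of `L` above `S`, and global reciprocity over the base `L` with ramification restricted to `T`
  obtain ⟨T, hT⟩ := exists_finset_forall_mem_iff_under_mem (K := K) L.1 S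
  have hmem := (forall_unramified_layer_pairing_eq_zero_iff_mk_mem_pow_sup_unitIdelesOutside (K := L.1) hm T x₀).1
    fun K' hK hab hunr χK =>
      classInvAll_baseCup_eq_zero_of_forall_layer_value_eq_zero_S S hL hm inv hinv φ H x₀ hx₀' T hT K' hK hab hunr χK
  obtain ⟨y, hy, z, hz, hyz⟩ := Subgroup.mem_sup.1 hmem
  obtain ⟨c, rfl⟩ := hy
  obtain ⟨u, hu, rfl⟩ := Subgroup.mem_map.1 hz
  -- `Ū_L^T = U_{L,S}` dies in `C̄_S`
  have hu0 : ofLayerS S hL (Additive.ofMul ((u : ideleGroup L.1) : IdeleClassGroup L.1)) = 0 := by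
    rw [← unitIdelesOff_eq_unitIdelesOutside S T hT] at hu
    rw [ofLayerS_eq_zero_iff S hL]
    exact ⟨Additive.ofMul ⟨u, hu⟩, rfl⟩
  -- `φ(1) = m • [c]`
  have hsum : Additive.ofMul (x₀ : IdeleClassGroup L.1) =
      m • Additive.ofMul (c : IdeleClassGroup L.1) + Additive.ofMul ((u : ideleGroup L.1) : IdeleClassGroup L.1) := by
    have h := congrArg Additive.ofMul hyz.symm
    rw [powMonoidHom_apply, ofMul_mul, ofMul_pow] at h
    exact h
  have hφ1 : φ.hom.hom (1 : ℤ) = m • ofLayerS S hL (Additive.ofMul (c : IdeleClassGroup L.1)) := by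
    rw [← hx₀']
    refine (congrArg (ofLayerS S hL) hsum).trans ?_
    refine (map_add (ofLayerS S hL) _ _).trans ?_
    refine (congrArg₂ (· + ·) (map_nsmul (ofLayerS S hL) m (Additive.ofMul (c : IdeleClassGroup L.1))) hu0).trans ?_
    exact add_zero _
  -- `φ₂`: the invariant vector `[c]` (door-c4 `homTrivEquiv`)
  have hcinv : ofLayerS S hL (Additive.ofMul (c : IdeleClassGroup L.1)) ∈
      ((resD ℤ (layerSubgroupS S L : Subgroup (GaloisGroupUnramifiedOutside K (↑S : Set (HeightOneSpectrum (𝓞 K)))))).obj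
        (classBarSD K S)).obj.ρ.invariants :=
    ofLayerS_mem_invariants_layerSubgroupS S hL _
  have hφ₂ := AddEquiv.apply_symm_apply (homTrivEquiv ((resD ℤ (layerSubgroupS S L : Subgroup (GaloisGroupUnramifiedOutside K
      (↑S : Set (HeightOneSpectrum (𝓞 K)))))).obj
        (classBarSD K S)) ℤ)
    (LinearMap.toSpanSingleton ℤ (((resD ℤ (layerSubgroupS S L : Subgroup (GaloisGroupUnramifiedOutside K (↑S : Set
        (HeightOneSpectrum (𝓞 K)))))).obj
        (classBarSD K S)).obj.ρ.invariants) ⟨_, hcinv⟩)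
  refine ⟨(homTrivEquiv ((resD ℤ (layerSubgroupS S L : Subgroup (GaloisGroupUnramifiedOutside K (↑S : Set (HeightOneSpectrum
      (𝓞 K)))))).obj
        (classBarSD K S)) ℤ).symm
    (LinearMap.toSpanSingleton ℤ (((resD ℤ (layerSubgroupS S L : Subgroup (GaloisGroupUnramifiedOutside K (↑S : Set
        (HeightOneSpectrum (𝓞 K)))))).obj
        (classBarSD K S)).obj.ρ.invariants) ⟨_, hcinv⟩), ?_⟩
  apply (homTrivEquiv ((resD ℤ (layerSubgroupS S L : Subgroup (GaloisGroupUnramifiedOutside K (↑S : Set (HeightOneSpectrum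
      (𝓞 K)))))).obj
        (classBarSD K S)) ℤ).injective
  rw [map_nsmul, hφ₂]
  refine LinearMap.ext_ring (Subtype.ext ?_)
  change m • ((LinearMap.toSpanSingleton ℤ (((resD ℤ (layerSubgroupS S L : Subgroup (GaloisGroupUnramifiedOutside K (↑S : Set
      (HeightOneSpectrum (𝓞 K)))))).obj
        (classBarSD K S)).obj.ρ.invariants) ⟨_, hcinv⟩) (1 : ℤ)).1 =
    (homTrivEquiv ((resD ℤ (layerSubgroupS S L : Subgroup (GaloisGroupUnramifiedOutside K (↑S : Set (HeightOneSpectrum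
        (𝓞 K)))))).obj
        (classBarSD K S)) ℤ φ (1 : ℤ)).1
  rw [homTrivEquiv_apply_coe, LinearMap.toSpanSingleton_apply_one, hφ1]
  rfl

end IdeleClassBar

end Literature.NumberTheory.GaloisRepresentations

end
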